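/-
Origin: expansion seat `prover-pub-hodgecm-mc-binder-1-g17-0`, handover #R113r2 2026-08-20T22:31:33Z md5 c32a978b13fd (127 l.; REPLACE of HodgeCM/Model/LiuDictionaryTower.lean — PKG file now 3333a968e9d7 (131 l., incl. packager Origin header); body of record 86d79d01f218 (127 l.) → c32a978b13fd; owner binder-1 #R113 (RUN 63); token strike only: LiuDictionary.ofTower hHD hI h₁ h₃ hA V Char Adm Ω PhiMu adm (no h₂); NAMES for audit: HodgeCM.Model.LiuDictionary.hIso_of_towerLevel · HodgeCM.Model.LiuDictionary.hIso_of_families) (`HOME/mc/pub-hodgecm-mc-binder-1-g17/campaign/new/LiuDictionaryTower.lean`, md5 c32a978b13fd, 127 lines);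
landed by the gen-27 packager (p-g27) in gate run 65 REPLACES the earlier landed copy of `HodgeCM/Model/LiuDictionaryTower.lean` (verbatim).
-/
/-
Copyright (c) 2026 the pub-hodgecm formalisation cell (harness21).  New file, not vendored.
Origin: session prover-pub-hodgecm-mc-binder-1-g16-0 (unit pub-hodgecm-mc-binder-1-g16, BINDER PROVER gen 16 of lineage mc-binder-1;
content lane (J-Liu-Θ), (J3) — the `H`/`res` half of axioms-1-g15's landed `Model/LiuDictionary` (RUN 62 #2) INSTANTIATED by the
tower #R105–#R111), 2026-08-20.
-/
import Summits.HodgeConjecture.HodgeCM.Model.LiuDictionary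
import Summits.HodgeConjecture.HodgeCM.Model.TowerRes
import Summits.HodgeConjecture.HodgeCM.Model.TowerAlgebra

/-!
# The tower instantiates the `H`/`res` half of the (J3) real-carrier dictionary

`Model/LiuDictionary` (axioms-1-g15, RUN 62) packages Liu's carriers `H, Char, Adm, Ω, PhiMu`, the identity-component restriction
`res Γ : H →ₗ[ℂ] H¹(P_Γ; ℂ)` and the CM-side comprehension `adm`, and proves the junction `subset_span_of_liuDictionary` whose
geometric input is

  `hIso : ∀ Γ, ∀ ω ∈ Θ Γ, ∃ x : T.H, x ∈ fixedBy Γ.K T.H ∧ T.res Γ x = ω ∧ x ∈ ⨆ μ ∈ S, T.block μ`.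

This leaf BUILDS `H` and `res` from the model: `H := Tower … V` (#R109: `colim_K H¹(X_K(ℂ); ℂ)` over the components `P_{Γ.conj h}`,
a `ℂ[U(V)(𝔸_f)]`-module by `Model/TowerAlgebra`) and `res Γ := resTotal … Γ` (#R111), leaving as PARAMETERS exactly the
adèlic-side carriers `Char, Adm, Ω, PhiMu` (sinst / theta-3: the `ω(μ,ε,χ)` as modules) and the CM-side comprehension `adm`
(binder-2 / (J5)):

* `LiuDictionary.ofTower … hA V Char Adm Ω PhiMu adm : LiuDictionary hHD hI h₁ h₃ V`; `ofTower_H`, `ofTower_res` (`rfl`);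
* `ofLevel_mem_fixedBy` — the images of the finite levels are `K`-fixed in the dictionary's `fixedBy`;
* **`hIso_of_towerLevel`** / **`hIso_of_families`** — the `hIso` hypothesis of the junction DISCHARGED from component data: for a class
  that is the identity-component value of a family `c ∈ H_K` (`x := ofLevel c`, `res Γ x = TowerLevel.res c` by #R111
  `resTotal_ofLevel`), given the (J4) input that the image lies in the prescribed sum of blocks (`hblock` / `hfam`).

Records used: the universe's `hHD hI h₁ h₃`, Arapura `hA` — all of record ((ii-b)-free since the (iib-T) re-cut).  No proof holes, nothing minted.
-/

noncomputable section

open Function Set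
open NumberField
open Literature.AlgebraicGeometry.Motives
open Literature.AlgebraicGeometry.ShimuraVarieties
open Literature.AlgebraicGeometry.HodgeTheory
open Literature.NumberTheory.Automorphic
open Literature.NumberTheory.Automorphic.PicardCM
open Literature.NumberTheory.Transcendental (Arapura2012_Cor_15_4_6)

namespace HodgeCM.Model

open HodgeCM.Model.TowerLevel HodgeCM.Model.TowerCarrier HodgeCM.Literature.Theta

variable (hHD : exists_isReal_hodgeModel) (hI : hodgePQ_independent_of_hodgeModel)
  (h₁ : BallQuotientUniformised) (h₃ : CMAbelianVarietyRealised) (hA : Arapura2012_Cor_15_4_6)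
variable {L : CMField} {ι₁ : L →+* ℂ}

namespace LiuDictionary

/-- **The dictionary with `H` and `res` BUILT from the tower.**  Parameters: the adèlic-side carriers (`Char`, `Adm`, `Ω` with their
`ℂ[U(V)(𝔸_f)]`-module structures, `PhiMu`) and the CM-side comprehension `adm`.  (An `abbrev`: the instance fields must reduce to
the tower's own instances at reducible transparency, so that lemmas about `(ofTower …).H` elaborate against `Tower … V`.) -/
abbrev ofTower (V : HermSpace3 L ι₁) (Char : Type) (Adm : Char → Type) (Ω : (μ : Char) → Adm μ → Type)
    [∀ μ a, AddCommGroup (Ω μ a)] [∀ μ a, Module ℂ (Ω μ a)] [∀ μ a, Module (adelicAlgebra V) (Ω μ a)]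
    [∀ μ a, IsScalarTower ℂ (adelicAlgebra V) (Ω μ a)] (PhiMu : Char → Prop) (adm : Char → LiuCMSide → Prop) :
    LiuDictionary hHD hI h₁ h₃ V where
  H := Tower hHD hI (ballQuotientUniformisedDatum_of h₁) h₃ hA V
  Char := Char
  Adm := Adm
  Ω := Ω
  PhiMu := PhiMu
  res Γ := resTotal hHD hI (ballQuotientUniformisedDatum_of h₁) h₃ hA Γ
  adm := adm

variable {V : HermSpace3 L ι₁} (Char : Type) (Adm : Char → Type) (Ω : (μ : Char) → Adm μ → Type)
    [∀ μ a, AddCommGroup (Ω μ a)] [∀ μ a, Module ℂ (Ω μ a)] [∀ μ a, Module (adelicAlgebra V) (Ω μ a)]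
    [∀ μ a, IsScalarTower ℂ (adelicAlgebra V) (Ω μ a)] (PhiMu : Char → Prop) (adm : Char → LiuCMSide → Prop)

/-- (Ported verbatim from the HodgeCMPerL package; no docstring in the source.) -/
theorem ofTower_H : (ofTower hHD hI h₁ h₃ hA V Char Adm Ω PhiMu adm).H =
    Tower hHD hI (ballQuotientUniformisedDatum_of h₁) h₃ hA V := rfl

/-- (Ported verbatim from the HodgeCMPerL package; no docstring in the source.) -/
theorem ofTower_res (Γ : Level V) : (ofTower hHD hI h₁ h₃ hA V Char Adm Ω PhiMu adm).res Γ =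
    resTotal hHD hI (ballQuotientUniformisedDatum_of h₁) h₃ hA Γ := rfl

/-- The images of the finite levels `H¹(X_K(ℂ); ℂ) → H` consist of `K`-fixed vectors (in the dictionary's `fixedBy`). -/
theorem ofLevel_mem_fixedBy {Γ : Level V} (hΓ : Γ.BelowConjThree)
    (c : towerLevel hHD hI (ballQuotientUniformisedDatum_of h₁) h₃ hA Γ hΓ) :
    (ofLevel hHD hI (ballQuotientUniformisedDatum_of h₁) h₃ hA Γ hΓ c :
        (ofTower hHD hI h₁ h₃ hA V Char Adm Ω PhiMu adm).H) ∈
      fixedBy Γ.K (ofTower hHD hI h₁ h₃ hA V Char Adm Ω PhiMu adm).H :=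
  (mem_fixedBy Γ.K _).mpr fun _ hk ↦ of_smul_ofLevel hHD hI (ballQuotientUniformisedDatum_of h₁) h₃ hA hΓ hk c

/-- **The `hIso` supplier.**  For a family `c ∈ H_K` of component classes (level `Γ`) whose identity-component value is `ω`, and
whose image in `H` lies in a prescribed subspace `P` ((J4): the sum of blocks), the junction's `hIso` triple holds at `ω`. -/
theorem hIso_of_towerLevel {Γ : Level V} (hΓ : Γ.BelowConjThree)
    (c : towerLevel hHD hI (ballQuotientUniformisedDatum_of h₁) h₃ hA Γ hΓ)
    {ω : (picardCMUniverse hHD hI h₁ h₃).CohC ((picardCMUniverse hHD hI h₁ h₃).pms L ι₁ V Γ) 1}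
    (hω : TowerLevel.res hHD hI (ballQuotientUniformisedDatum_of h₁) h₃ hA c = ω)
    (P : Submodule ℂ (ofTower hHD hI h₁ h₃ hA V Char Adm Ω PhiMu adm).H)
    (hblock : (ofLevel hHD hI (ballQuotientUniformisedDatum_of h₁) h₃ hA Γ hΓ c :
      (ofTower hHD hI h₁ h₃ hA V Char Adm Ω PhiMu adm).H) ∈ P) :
    ∃ x : (ofTower hHD hI h₁ h₃ hA V Char Adm Ω PhiMu adm).H,
      x ∈ fixedBy Γ.K (ofTower hHD hI h₁ h₃ hA V Char Adm Ω PhiMu adm).H ∧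
        (ofTower hHD hI h₁ h₃ hA V Char Adm Ω PhiMu adm).res Γ x = ω ∧ x ∈ P :=
  ⟨ofLevel hHD hI (ballQuotientUniformisedDatum_of h₁) h₃ hA Γ hΓ c,
    ofLevel_mem_fixedBy hHD hI h₁ h₃ hA Char Adm Ω PhiMu adm hΓ c,
    (resTotal_ofLevel hHD hI (ballQuotientUniformisedDatum_of h₁) h₃ hA Γ hΓ c).trans hω, hblock⟩

/-- **The `hIso` hypothesis of `subset_span_of_liuDictionary`, discharged from component data**: if every class of `Θ Γ` (at a
level of the tower) is the identity-component value of a family `c ∈ H_K` whose image lies in `⨆ μ ∈ S, block μ`, then `hIso` holds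
at that level.  (Levels not below a conjugate of `K_f(3)` are excluded by the caller's `Γ₀ ≤ Level.three`.) -/
theorem hIso_of_families (S : Finset (ofTower hHD hI h₁ h₃ hA V Char Adm Ω PhiMu adm).Char)
    (Θ : ∀ Γ : Level V, Set ((picardCMUniverse hHD hI h₁ h₃).CohC ((picardCMUniverse hHD hI h₁ h₃).pms L ι₁ V Γ) 1))
    (Γ : Level V) (hΓ : Γ.BelowConjThree)
    (hfam : ∀ ω ∈ Θ Γ, ∃ c : towerLevel hHD hI (ballQuotientUniformisedDatum_of h₁) h₃ hA Γ hΓ,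
      TowerLevel.res hHD hI (ballQuotientUniformisedDatum_of h₁) h₃ hA c = ω ∧
        (ofLevel hHD hI (ballQuotientUniformisedDatum_of h₁) h₃ hA Γ hΓ c :
            (ofTower hHD hI h₁ h₃ hA V Char Adm Ω PhiMu adm).H) ∈
          ⨆ μ ∈ S, (ofTower hHD hI h₁ h₃ hA V Char Adm Ω PhiMu adm).block μ) :
    ∀ ω ∈ Θ Γ, ∃ x : (ofTower hHD hI h₁ h₃ hA V Char Adm Ω PhiMu adm).H,
      x ∈ fixedBy Γ.K (ofTower hHD hI h₁ h₃ hA V Char Adm Ω PhiMu adm).H ∧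
        (ofTower hHD hI h₁ h₃ hA V Char Adm Ω PhiMu adm).res Γ x = ω ∧
          x ∈ ⨆ μ ∈ S, (ofTower hHD hI h₁ h₃ hA V Char Adm Ω PhiMu adm).block μ := by
  intro ω hω
  obtain ⟨c, hc, hblock⟩ := hfam ω hω
  exact hIso_of_towerLevel hHD hI h₁ h₃ hA Char Adm Ω PhiMu adm hΓ c hc _ hblock

end LiuDictionary

end HodgeCM.Model

end
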